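import Literature.MathematicalPhysics.QuantumLattice.HubbardTTPrimeDiagHopTransport
import Literature.MathematicalPhysics.QuantumLattice.HubbardTTPrimeEnergyDensityVariationalPrinciple
import HarnessLib

/-!
# `t'`-transport for EVERY translation-invariant mean-energy minimiser (in particular every
# translation-invariant ground state in the Bratteli–Robinson sense), not only torus limits

Family `hubbard` (topic `MathematicalPhysics/QuantumLattice`); companion of
`HubbardTTPrimeDiagHopTransport` (the same rows for the torus-limit ground-state class). The words that
certificates produce are statements about TORUS-LIMIT sector ground states at a coupling; the material
oracle's sentence "for every ground state of the box" is naturally read in the larger class of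
translation-invariant infinite-volume states `ω` of density `n ∈ (0,2)` that MINIMISE the mean energy at
their own coupling, `e_{Φ(t,s,U)}(ω) ≤ e(t,s,U,n)` (`= ` then holds by the variational principle
`IsTranslationInvariant.energyDensityTT'_le_meanEnergy`). This class contains every torus-limit sector
ground state (`IsTorusLimitOf.meanEnergy_hubbardTTPrime_eq_energyDensityTT'`) and every
translation-invariant ground state of `H(t,s,U) − μN` in the Bratteli–Robinson sense
(`meanEnergy_eq_energyDensityTT'_of_groundState`, `IsGroundState.meanEnergy_eq_energyDensityTT'`, file
`FermionGroundStatesMinimiseMeanEnergy` — not imported here; feed its conclusion as `hmin`). Everything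
below is the cross-variational comparison of such an `ω` at `t' = s` with a torus-limit ground state at
ANOTHER coupling `s₁ ≠ s` (Koma–Tasaki / Griffiths monotonicity of the conjugate observable), so the
endpoint words transport to the minimiser class at every INTERIOR point of the box (at `s = s₁` itself
two minimisers may have different slopes — a first-order point — and nothing is claimed):

* §1 the kinematic `K₂` row for translation-invariant states, `|K₂(ω)| ≤ 16/π²`
  (`IsTranslationInvariant.abs_meanEnergy_diagHop_le`; the torus-limit form is
  `IsTorusLimitOf.abs_meanEnergy_diagHop_le`);
* §2 word transport: a ceiling word `A` at `s₁ < s` (for torus-limit ground states of density `n`) gives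
  `K₂(ω) ≤ A`, a floor word `B` at `s₂ > s` gives `B ≤ K₂(ω)`
  (`IsTranslationInvariant.meanEnergy_diagHop_le_of_minimiser_of_forall_lt`,
  `…le_meanEnergy_diagHop_of_minimiser_of_forall_gt`);
* §3 cap transport: `e(t,s₀,U,n) ≤ e_{Φ(t,s₀,U)}(ω) ≤ e(t,s₀,U,n) + (s − s₀)(K₂(ω₀) − K₂(ω))` against any
  torus-limit ground state `ω₀` at the anchor (`…meanEnergy_anchor_mem_Icc_of_minimiser_of_groundState`),
  hence `≤ e(t,s₀,U,n) + |s − s₀|(A − B)` for `s` in the OPEN box `(s₁, s₂)` from the endpoint words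
  (`…_of_forall_endpoints`) and `≤ e(t,s₀,U,n) + (32/π²)|s − s₀|` word-free (`…_kinematic`);
* §4 BOX ⇒ WORD for the minimiser class: a property certified for every translation-invariant state of
  density `n` under the anchor cap `e_{Φ(t,s₀,U)}(ω) ≤ u`, booked with
  `u ≥ u₀ + max(s₂ − s₀, s₀ − s₁)(A − B)` (resp. `·32/π²`), holds for every minimiser at every
  `s ∈ (s₁, s₂)` (resp. every `s`) (`forall_minimiser_tPrime_box_of_forall_cap`, `…_kinematic`).

HONEST FRAMING: bookkeeping for the systematic → certified interface; no number, no definition, no named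
fact; everything PROVED.

## Mathlib / tree search

REUSED: `InfVolFermionState.diagHopEnergy_anti_of_cross_variational`, `meanEnergy_hubbardTTPrime_affine`,
`meanEnergy_hubbardTTPrime_smul` (`HubbardTTPrimeCapCutDualRows`, `HubbardTTPrimeMeanEnergySupergradient`);
`IsTranslationInvariant.energyDensityTT'_le_meanEnergy`, `energyDensityTT'_le_meanEnergy_of_isTranslationInvariant`
(`HubbardTTPrimeEnergyDensityVariationalPrinciple`); `IsTorusLimitOf.meanEnergy_hubbardTTPrime_eq_energyDensityTT'`,
`IsTorusLimitOf.energyDensityTT'_le_meanEnergy_hubbardTTPrime`, `IsTorusLimitOf.energyDensityTT'_sub_le_mul_meanEnergy_diag`,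
`exists_isTorusLimitOf_squareGroundStatesTT'_meanEnergy_eq`; the torus-class rows of `HubbardTTPrimeDiagHopTransport`
(`IsTorusLimitOf.meanEnergy_diagHop_mem_Icc_of_forall_endpoints`, `IsTorusLimitOf.abs_meanEnergy_diagHop_le`);
`neg_sixteen_mul_abs_div_pi_sq_le_energyDensityTT'_diag`. `lean search 'IsTranslationInvariant.(abs_)?meanEnergy_diagHop'
--decl`: nothing.

## References

* T. Koma, H. Tasaki, J. Stat. Phys. 76 (1994) 745, §1 and App. A (concavity in a coupling; ground states
  minimise the mean energy). [cite: KomaTasaki1994, §1]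
* R. B. Griffiths, Phys. Rev. 152 (1966) 240, §II. [cite: Griffiths1966, §II]
* O. Bratteli, A. Kishimoto, D. W. Robinson, Commun. Math. Phys. 64 (1978) 41, Thm. 2 (translation-
  invariant ground states minimise the mean energy). [cite: BratteliKishimotoRobinson1978, §3 Thm. 2]
* J. Wang et al., PRX 14 (2024) 031006, §III (bounds valid for every state under an energy constraint).
  [cite: WangEtAl2024, §III]
* E. H. Lieb, M. Loss, Duke Math. J. 71 (1993) 337, §8 Thm. 8.2 (bathtub). [cite: LiebLoss1993, §8, Theorem 8.2]
-/

noncomputable section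

namespace Literature.MathematicalPhysics.QuantumLattice

open Matrix Finset HubbardWave0 Literature.Probability.LatticeModels ThermodynamicLimit
open _root_.Filter
open scoped _root_.Topology ComplexOrder BigOperators

namespace InfVolFermionState

variable {ω : InfVolFermionState 2}

/-! ### §1 The kinematic `K₂` row for translation-invariant states -/

/-- **`|K₂(ω)| ≤ 16/π²` for every translation-invariant state of density `n ∈ (0,2)`**: the variational
inequality at the couplings `(0, ±1, 0)` (`e(0,±1,0,n) ≤ ±K₂(ω)`) and the diagonal-band floor
`−16/π² ≤ e(0,±1,0,n)`. [cite: LiebLoss1993, §8, Theorem 8.2] [cite: Ruelle1969, §3.4] -/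
theorem IsTranslationInvariant.abs_meanEnergy_diagHop_le (hω : ω.IsTranslationInvariant) {n : ℝ}
    (hρ : ω.density = n) (hn0 : 0 < n) (hn2 : n < 2) :
    |ω.meanEnergy (hubbardTTPrimeFermionInteraction 0 1 0) 1| ≤ 16 / Real.pi ^ 2 := by
  have hv1 := energyDensityTT'_le_meanEnergy_of_isTranslationInvariant 0 1 le_rfl hn0 hn2 hω hρ
  have hv2 := energyDensityTT'_le_meanEnergy_of_isTranslationInvariant 0 (-1) le_rfl hn0 hn2 hω hρ
  have hf1 := neg_sixteen_mul_abs_div_pi_sq_le_energyDensityTT'_diag 1 le_rfl hn0.le hn2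
  have hf2 := neg_sixteen_mul_abs_div_pi_sq_le_energyDensityTT'_diag (-1) le_rfl hn0.le hn2
  rw [abs_one, mul_one] at hf1
  rw [abs_neg, abs_one, mul_one] at hf2
  have hsm : ω.meanEnergy (hubbardTTPrimeFermionInteraction 0 (-1) 0) 1 =
      -1 * ω.meanEnergy (hubbardTTPrimeFermionInteraction 0 1 0) 1 := by
    have hs := ω.meanEnergy_hubbardTTPrime_smul (-1) 0 1 0
    rwa [mul_zero, mul_one] at hs
  rw [hsm] at hv2
  rw [neg_div] at hf1 hf2
  rw [abs_le]
  constructor <;> linarith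

/-! ### §2 Endpoint words transport to every minimiser at an interior point -/

/-- **A ceiling word moves to the right, onto every minimiser.** Let `ω` be translation invariant with
density `n ∈ (0,2)` and a mean-energy minimiser at `(t, s, U)` (`U ≥ 0`):
`e_{Φ(t,s,U)}(ω) ≤ e(t,s,U,n)`. If every torus-limit ground state `ω₁` at `(t, s₁, U)`, density `n`,
with `s₁ < s`, has `K₂(ω₁) ≤ A`, then `K₂(ω) ≤ A` (cross-variational comparison of `ω` with one such `ω₁`).
[cite: KomaTasaki1994, §1] [cite: Griffiths1966, §II] -/
theorem IsTranslationInvariant.meanEnergy_diagHop_le_of_minimiser_of_forall_lt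
    (hω : ω.IsTranslationInvariant) (t : ℝ) {s₁ s : ℝ} (hs : s₁ < s) {U : ℝ} (hU : 0 ≤ U) {n : ℝ}
    (hρ : ω.density = n) (hn0 : 0 < n) (hn2 : n < 2)
    (hmin : ω.meanEnergy (hubbardTTPrimeFermionInteraction t s U) 1 ≤ energyDensityTT' t s U n) {A : ℝ}
    (hA : ∀ (ω₁ : InfVolFermionState 2) (Ls₁ : ℕ → ℕ) (ψ₁ : ∀ L, Fock (Orb (FermionTorus 2 L))),
      Tendsto Ls₁ atTop atTop →
      (∀ j, IsGroundStateInSector (hubbardTorusTT' (Ls₁ j) t s₁ U) (rectN n (Ls₁ j)) 0 (ψ₁ (Ls₁ j))) →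
      (∀ j, star (ψ₁ (Ls₁ j)) ⬝ᵥ ψ₁ (Ls₁ j) = 1) → ω₁.IsTorusLimitOf ψ₁ Ls₁ →
      ω₁.meanEnergy (hubbardTTPrimeFermionInteraction 0 1 0) 1 ≤ A) :
    ω.meanEnergy (hubbardTTPrimeFermionInteraction 0 1 0) 1 ≤ A := by
  obtain ⟨ψ₁, Ls₁, ω₁, hLs₁, hω₁, -, -, h1₁, hψ₁, -, -, -⟩ :=
    exists_isTorusLimitOf_squareGroundStatesTT'_meanEnergy_eq t s₁ hU hn0.le hn2
  have hN₁ : ∀ j, IsNParticle (rectN n (Ls₁ j)) (ψ₁ (Ls₁ j)) := fun j =>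
    ((mem_szSector_iff _ _ _).1 (hψ₁ j).1).1
  have hP : ω.meanEnergy (hubbardTTPrimeFermionInteraction t s U) 1 ≤
      ω₁.meanEnergy (hubbardTTPrimeFermionInteraction t s U) 1 :=
    hmin.trans (hω₁.energyDensityTT'_le_meanEnergy_hubbardTTPrime t s hU hn0.le hn2 hLs₁ hN₁ h1₁)
  have hAx : ω₁.meanEnergy (hubbardTTPrimeFermionInteraction t s₁ U) 1 ≤
      ω.meanEnergy (hubbardTTPrimeFermionInteraction t s₁ U) 1 := by
    rw [hω₁.meanEnergy_hubbardTTPrime_eq_energyDensityTT' t s₁ hU hn0.le hn2 hLs₁ hψ₁ h1₁]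
    exact energyDensityTT'_le_meanEnergy_of_isTranslationInvariant t s₁ hU hn0 hn2 hω hρ
  exact (diagHopEnergy_anti_of_cross_variational ω ω₁ hs hP hAx).trans (hA ω₁ Ls₁ ψ₁ hLs₁ hψ₁ h1₁ hω₁)

/-- **A floor word moves to the left, onto every minimiser**: with `ω` as above at `(t, s, U)` and a
floor word `B` at `s₂ > s` (every torus-limit ground state at `(t, s₂, U)`, density `n`, has
`B ≤ K₂`), `B ≤ K₂(ω)`. [cite: KomaTasaki1994, §1] [cite: Griffiths1966, §II] -/
theorem IsTranslationInvariant.le_meanEnergy_diagHop_of_minimiser_of_forall_gt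
    (hω : ω.IsTranslationInvariant) (t : ℝ) {s s₂ : ℝ} (hs : s < s₂) {U : ℝ} (hU : 0 ≤ U) {n : ℝ}
    (hρ : ω.density = n) (hn0 : 0 < n) (hn2 : n < 2)
    (hmin : ω.meanEnergy (hubbardTTPrimeFermionInteraction t s U) 1 ≤ energyDensityTT' t s U n) {B : ℝ}
    (hB : ∀ (ω₂ : InfVolFermionState 2) (Ls₂ : ℕ → ℕ) (ψ₂ : ∀ L, Fock (Orb (FermionTorus 2 L))),
      Tendsto Ls₂ atTop atTop →
      (∀ j, IsGroundStateInSector (hubbardTorusTT' (Ls₂ j) t s₂ U) (rectN n (Ls₂ j)) 0 (ψ₂ (Ls₂ j))) →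
      (∀ j, star (ψ₂ (Ls₂ j)) ⬝ᵥ ψ₂ (Ls₂ j) = 1) → ω₂.IsTorusLimitOf ψ₂ Ls₂ →
      B ≤ ω₂.meanEnergy (hubbardTTPrimeFermionInteraction 0 1 0) 1) :
    B ≤ ω.meanEnergy (hubbardTTPrimeFermionInteraction 0 1 0) 1 := by
  obtain ⟨ψ₂, Ls₂, ω₂, hLs₂, hω₂, -, -, h1₂, hψ₂, -, -, -⟩ :=
    exists_isTorusLimitOf_squareGroundStatesTT'_meanEnergy_eq t s₂ hU hn0.le hn2
  have hN₂ : ∀ j, IsNParticle (rectN n (Ls₂ j)) (ψ₂ (Ls₂ j)) := fun j =>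
    ((mem_szSector_iff _ _ _).1 (hψ₂ j).1).1
  -- `P = ω₂` (at `s₂`), `A = ω` (at `s`)
  have hP : ω₂.meanEnergy (hubbardTTPrimeFermionInteraction t s₂ U) 1 ≤
      ω.meanEnergy (hubbardTTPrimeFermionInteraction t s₂ U) 1 := by
    rw [hω₂.meanEnergy_hubbardTTPrime_eq_energyDensityTT' t s₂ hU hn0.le hn2 hLs₂ hψ₂ h1₂]
    exact energyDensityTT'_le_meanEnergy_of_isTranslationInvariant t s₂ hU hn0 hn2 hω hρ
  have hAx : ω.meanEnergy (hubbardTTPrimeFermionInteraction t s U) 1 ≤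
      ω₂.meanEnergy (hubbardTTPrimeFermionInteraction t s U) 1 :=
    hmin.trans (hω₂.energyDensityTT'_le_meanEnergy_hubbardTTPrime t s hU hn0.le hn2 hLs₂ hN₂ h1₂)
  exact (hB ω₂ Ls₂ ψ₂ hLs₂ hψ₂ h1₂ hω₂).trans (diagHopEnergy_anti_of_cross_variational ω₂ ω hs hP hAx)

/-! ### §3 Cap transport for minimisers -/

/-- **The anchor window of a minimiser (two-state form).** Let `ω` be translation invariant, density
`n ∈ (0,2)`, a mean-energy minimiser at `(t, s, U)` (`U ≥ 0`), and `ω₀` a torus-limit ground state at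
the anchor `(t, s₀, U)`, density `n`. Then
`e(t,s₀,U,n) ≤ e_{Φ(t,s₀,U)}(ω) ≤ e(t,s₀,U,n) + (s − s₀)·(K₂(ω₀) − K₂(ω))`.
[cite: KomaTasaki1994, §1] [cite: WangEtAl2024, §III] -/
theorem IsTranslationInvariant.meanEnergy_anchor_mem_Icc_of_minimiser_of_groundState
    (hω : ω.IsTranslationInvariant) (t s₀ s : ℝ) {U : ℝ} (hU : 0 ≤ U) {n : ℝ} (hρ : ω.density = n)
    (hn0 : 0 < n) (hn2 : n < 2)
    (hmin : ω.meanEnergy (hubbardTTPrimeFermionInteraction t s U) 1 ≤ energyDensityTT' t s U n)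
    {ω₀ : InfVolFermionState 2} {ψ₀ : ∀ L, Fock (Orb (FermionTorus 2 L))} {Ls₀ : ℕ → ℕ}
    (h₀ : ω₀.IsTorusLimitOf ψ₀ Ls₀) (hLs₀ : Tendsto Ls₀ atTop atTop)
    (hψ₀ : ∀ j, IsGroundStateInSector (hubbardTorusTT' (Ls₀ j) t s₀ U) (rectN n (Ls₀ j)) 0 (ψ₀ (Ls₀ j)))
    (h1₀ : ∀ j, star (ψ₀ (Ls₀ j)) ⬝ᵥ ψ₀ (Ls₀ j) = 1) :
    ω.meanEnergy (hubbardTTPrimeFermionInteraction t s₀ U) 1 ∈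
      Set.Icc (energyDensityTT' t s₀ U n)
        (energyDensityTT' t s₀ U n +
          (s - s₀) * (ω₀.meanEnergy (hubbardTTPrimeFermionInteraction 0 1 0) 1 -
            ω.meanEnergy (hubbardTTPrimeFermionInteraction 0 1 0) 1)) := by
  refine ⟨energyDensityTT'_le_meanEnergy_of_isTranslationInvariant t s₀ hU hn0 hn2 hω hρ, ?_⟩
  have haff := ω.meanEnergy_hubbardTTPrime_affine t s U s₀ U
  have htan := h₀.energyDensityTT'_sub_le_mul_meanEnergy_diag t s₀ hU hn0.le hn2 hLs₀ hψ₀ h1₀ s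
  rw [haff, sub_self, zero_mul, add_zero]
  linarith

/-- **The anchor window of a minimiser from the endpoint words** (open box): ceiling word `A` at `s₁`,
floor word `B` at `s₂`, anchor `s₀ ∈ [s₁, s₂]`, and `ω` a translation-invariant minimiser of density
`n ∈ (0,2)` at `(t, s, U)` with `s ∈ (s₁, s₂)`:
`e(t,s₀,U,n) ≤ e_{Φ(t,s₀,U)}(ω) ≤ e(t,s₀,U,n) + |s − s₀|·(A − B)`.
[cite: KomaTasaki1994, §1] [cite: WangEtAl2024, §III] -/
theorem IsTranslationInvariant.meanEnergy_anchor_mem_Icc_of_minimiser_of_forall_endpoints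
    (hω : ω.IsTranslationInvariant) (t : ℝ) {s₁ s₂ s₀ s : ℝ} (hs₀ : s₀ ∈ Set.Icc s₁ s₂)
    (hs : s ∈ Set.Ioo s₁ s₂) {U : ℝ} (hU : 0 ≤ U) {n : ℝ} (hρ : ω.density = n) (hn0 : 0 < n)
    (hn2 : n < 2)
    (hmin : ω.meanEnergy (hubbardTTPrimeFermionInteraction t s U) 1 ≤ energyDensityTT' t s U n)
    {A B : ℝ}
    (hA : ∀ (ω₁ : InfVolFermionState 2) (Ls₁ : ℕ → ℕ) (ψ₁ : ∀ L, Fock (Orb (FermionTorus 2 L))),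
      Tendsto Ls₁ atTop atTop →
      (∀ j, IsGroundStateInSector (hubbardTorusTT' (Ls₁ j) t s₁ U) (rectN n (Ls₁ j)) 0 (ψ₁ (Ls₁ j))) →
      (∀ j, star (ψ₁ (Ls₁ j)) ⬝ᵥ ψ₁ (Ls₁ j) = 1) → ω₁.IsTorusLimitOf ψ₁ Ls₁ →
      ω₁.meanEnergy (hubbardTTPrimeFermionInteraction 0 1 0) 1 ≤ A)
    (hB : ∀ (ω₂ : InfVolFermionState 2) (Ls₂ : ℕ → ℕ) (ψ₂ : ∀ L, Fock (Orb (FermionTorus 2 L))),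
      Tendsto Ls₂ atTop atTop →
      (∀ j, IsGroundStateInSector (hubbardTorusTT' (Ls₂ j) t s₂ U) (rectN n (Ls₂ j)) 0 (ψ₂ (Ls₂ j))) →
      (∀ j, star (ψ₂ (Ls₂ j)) ⬝ᵥ ψ₂ (Ls₂ j) = 1) → ω₂.IsTorusLimitOf ψ₂ Ls₂ →
      B ≤ ω₂.meanEnergy (hubbardTTPrimeFermionInteraction 0 1 0) 1) :
    ω.meanEnergy (hubbardTTPrimeFermionInteraction t s₀ U) 1 ∈
      Set.Icc (energyDensityTT' t s₀ U n) (energyDensityTT' t s₀ U n + |s - s₀| * (A - B)) := by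
  obtain ⟨ψ₀, Ls₀, ω₀, hLs₀, hω₀, -, -, h1₀, hψ₀, -, -, -⟩ :=
    exists_isTorusLimitOf_squareGroundStatesTT'_meanEnergy_eq t s₀ hU hn0.le hn2
  obtain ⟨hlo, hhi⟩ := hω.meanEnergy_anchor_mem_Icc_of_minimiser_of_groundState t s₀ s hU hρ hn0 hn2
    hmin hω₀ hLs₀ hψ₀ h1₀
  refine ⟨hlo, hhi.trans ?_⟩
  obtain ⟨hB₀, hA₀⟩ := hω₀.meanEnergy_diagHop_mem_Icc_of_forall_endpoints t hs₀ hU hn0.le hn2 hA hB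
    hLs₀ hψ₀ h1₀
  have hAω := hω.meanEnergy_diagHop_le_of_minimiser_of_forall_lt t hs.1 hU hρ hn0 hn2 hmin hA
  have hBω := hω.le_meanEnergy_diagHop_of_minimiser_of_forall_gt t hs.2 hU hρ hn0 hn2 hmin hB
  set x := ω₀.meanEnergy (hubbardTTPrimeFermionInteraction 0 1 0) 1 -
    ω.meanEnergy (hubbardTTPrimeFermionInteraction 0 1 0) 1 with hx
  have hxabs : |x| ≤ A - B := abs_le.2 ⟨by linarith, by linarith⟩
  have hle : (s - s₀) * x ≤ |s - s₀| * (A - B) :=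
    calc (s - s₀) * x ≤ |(s - s₀) * x| := le_abs_self _
      _ = |s - s₀| * |x| := abs_mul _ _
      _ ≤ |s - s₀| * (A - B) := mul_le_mul_of_nonneg_left hxabs (abs_nonneg _)
  linarith

/-- **Word-free anchor window of a minimiser**: for any `s₀, s` and `ω` a translation-invariant
minimiser of density `n ∈ (0,2)` at `(t, s, U)`:
`e(t,s₀,U,n) ≤ e_{Φ(t,s₀,U)}(ω) ≤ e(t,s₀,U,n) + (32/π²)|s − s₀|`.
[cite: LiebLoss1993, §8, Theorem 8.2] [cite: KomaTasaki1994, §1] -/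
theorem IsTranslationInvariant.meanEnergy_anchor_mem_Icc_of_minimiser_kinematic
    (hω : ω.IsTranslationInvariant) (t s₀ s : ℝ) {U : ℝ} (hU : 0 ≤ U) {n : ℝ} (hρ : ω.density = n)
    (hn0 : 0 < n) (hn2 : n < 2)
    (hmin : ω.meanEnergy (hubbardTTPrimeFermionInteraction t s U) 1 ≤ energyDensityTT' t s U n) :
    ω.meanEnergy (hubbardTTPrimeFermionInteraction t s₀ U) 1 ∈
      Set.Icc (energyDensityTT' t s₀ U n) (energyDensityTT' t s₀ U n + 32 / Real.pi ^ 2 * |s - s₀|) := by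
  obtain ⟨ψ₀, Ls₀, ω₀, hLs₀, hω₀, -, -, h1₀, hψ₀, -, -, -⟩ :=
    exists_isTorusLimitOf_squareGroundStatesTT'_meanEnergy_eq t s₀ hU hn0.le hn2
  obtain ⟨hlo, hhi⟩ := hω.meanEnergy_anchor_mem_Icc_of_minimiser_of_groundState t s₀ s hU hρ hn0 hn2
    hmin hω₀ hLs₀ hψ₀ h1₀
  refine ⟨hlo, hhi.trans ?_⟩
  have hN₀ : ∀ j, IsNParticle (rectN n (Ls₀ j)) (ψ₀ (Ls₀ j)) := fun j =>
    ((mem_szSector_iff _ _ _).1 (hψ₀ j).1).1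
  have hK₀ := hω₀.abs_meanEnergy_diagHop_le hn0.le hn2 hLs₀ hN₀ h1₀
  have hK := hω.abs_meanEnergy_diagHop_le hρ hn0 hn2
  set x := ω₀.meanEnergy (hubbardTTPrimeFermionInteraction 0 1 0) 1 -
    ω.meanEnergy (hubbardTTPrimeFermionInteraction 0 1 0) 1 with hx
  have hxabs : |x| ≤ 32 / Real.pi ^ 2 := by
    calc |x| ≤ |ω₀.meanEnergy (hubbardTTPrimeFermionInteraction 0 1 0) 1| +
          |ω.meanEnergy (hubbardTTPrimeFermionInteraction 0 1 0) 1| := abs_sub _ _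
      _ ≤ 16 / Real.pi ^ 2 + 16 / Real.pi ^ 2 := add_le_add hK₀ hK
      _ = 32 / Real.pi ^ 2 := by ring
  have hle : (s - s₀) * x ≤ 32 / Real.pi ^ 2 * |s - s₀| :=
    calc (s - s₀) * x ≤ |(s - s₀) * x| := le_abs_self _
      _ = |s - s₀| * |x| := abs_mul _ _
      _ ≤ |s - s₀| * (32 / Real.pi ^ 2) := mul_le_mul_of_nonneg_left hxabs (abs_nonneg _)
      _ = 32 / Real.pi ^ 2 * |s - s₀| := mul_comm _ _
  linarith

/-! ### §4 BOX ⇒ WORD for the minimiser class -/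

/-- **BOX ⇒ WORD, minimiser class (endpoint words).** Box `[s₁, s₂]` with ceiling word `A` at `s₁`
and floor word `B` at `s₂` (torus-limit ground states of density `n ∈ (0,2)`), anchor `s₀ ∈ [s₁, s₂]`
with cap `e(t,s₀,U,n) ≤ u₀`, and a property `P` certified for every TRANSLATION-INVARIANT state of
density `n` under the anchor cap `e_{Φ(t,s₀,U)}(ω) ≤ u`, booked with
`u₀ + max(s₂ − s₀, s₀ − s₁)·(A − B) ≤ u`. Then `P ω` for every translation-invariant mean-energy
minimiser `ω` of density `n` at every `t' = s ∈ (s₁, s₂)`. [cite: WangEtAl2024, §III] [cite: KomaTasaki1994, §1] -/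
theorem forall_minimiser_tPrime_box_of_forall_cap (t : ℝ) {s₁ s₂ s₀ : ℝ} (hs₀ : s₀ ∈ Set.Icc s₁ s₂)
    {U : ℝ} (hU : 0 ≤ U) {n : ℝ} (hn0 : 0 < n) (hn2 : n < 2) {u₀ u A B : ℝ}
    (hu₀ : energyDensityTT' t s₀ U n ≤ u₀)
    (hA : ∀ (ω₁ : InfVolFermionState 2) (Ls₁ : ℕ → ℕ) (ψ₁ : ∀ L, Fock (Orb (FermionTorus 2 L))),
      Tendsto Ls₁ atTop atTop →
      (∀ j, IsGroundStateInSector (hubbardTorusTT' (Ls₁ j) t s₁ U) (rectN n (Ls₁ j)) 0 (ψ₁ (Ls₁ j))) →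
      (∀ j, star (ψ₁ (Ls₁ j)) ⬝ᵥ ψ₁ (Ls₁ j) = 1) → ω₁.IsTorusLimitOf ψ₁ Ls₁ →
      ω₁.meanEnergy (hubbardTTPrimeFermionInteraction 0 1 0) 1 ≤ A)
    (hB : ∀ (ω₂ : InfVolFermionState 2) (Ls₂ : ℕ → ℕ) (ψ₂ : ∀ L, Fock (Orb (FermionTorus 2 L))),
      Tendsto Ls₂ atTop atTop →
      (∀ j, IsGroundStateInSector (hubbardTorusTT' (Ls₂ j) t s₂ U) (rectN n (Ls₂ j)) 0 (ψ₂ (Ls₂ j))) →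
      (∀ j, star (ψ₂ (Ls₂ j)) ⬝ᵥ ψ₂ (Ls₂ j) = 1) → ω₂.IsTorusLimitOf ψ₂ Ls₂ →
      B ≤ ω₂.meanEnergy (hubbardTTPrimeFermionInteraction 0 1 0) 1)
    (hu : u₀ + max (s₂ - s₀) (s₀ - s₁) * (A - B) ≤ u)
    {P : InfVolFermionState 2 → Prop}
    (hP : ∀ ω : InfVolFermionState 2, ω.IsTranslationInvariant → ω.density = n →
      ω.meanEnergy (hubbardTTPrimeFermionInteraction t s₀ U) 1 ≤ u → P ω)
    {s : ℝ} (hs : s ∈ Set.Ioo s₁ s₂) {ω : InfVolFermionState 2} (hω : ω.IsTranslationInvariant)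
    (hρ : ω.density = n)
    (hmin : ω.meanEnergy (hubbardTTPrimeFermionInteraction t s U) 1 ≤ energyDensityTT' t s U n) :
    P ω := by
  refine hP ω hω hρ ?_
  obtain ⟨-, hcap⟩ := hω.meanEnergy_anchor_mem_Icc_of_minimiser_of_forall_endpoints t hs₀ hs hU hρ hn0
    hn2 hmin hA hB
  have hAω := hω.meanEnergy_diagHop_le_of_minimiser_of_forall_lt t hs.1 hU hρ hn0 hn2 hmin hA
  have hBω := hω.le_meanEnergy_diagHop_of_minimiser_of_forall_gt t hs.2 hU hρ hn0 hn2 hmin hB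
  have hAB : 0 ≤ A - B := by linarith
  have hdist : |s - s₀| ≤ max (s₂ - s₀) (s₀ - s₁) := by
    rw [abs_le]
    constructor
    · have := le_max_right (s₂ - s₀) (s₀ - s₁)
      linarith [hs.1]
    · have := le_max_left (s₂ - s₀) (s₀ - s₁)
      linarith [hs.2]
  have := mul_le_mul_of_nonneg_right hdist hAB
  linarith

/-- **BOX ⇒ WORD, minimiser class (kinematic, no words)**: with the universal inflation
`u₀ + (32/π²)·max(s₂ − s₀, s₀ − s₁) ≤ u` the conclusion holds for every translation-invariant minimiser
of density `n` at every `s ∈ [s₁, s₂]` (closed box; anchor anywhere).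
[cite: WangEtAl2024, §III] [cite: LiebLoss1993, §8, Theorem 8.2] -/
theorem forall_minimiser_tPrime_box_of_forall_cap_kinematic (t : ℝ) {s₁ s₂ : ℝ} (s₀ : ℝ)
    {U : ℝ} (hU : 0 ≤ U) {n : ℝ} (hn0 : 0 < n) (hn2 : n < 2) {u₀ u : ℝ}
    (hu₀ : energyDensityTT' t s₀ U n ≤ u₀)
    (hu : u₀ + 32 / Real.pi ^ 2 * max (s₂ - s₀) (s₀ - s₁) ≤ u)
    {P : InfVolFermionState 2 → Prop}
    (hP : ∀ ω : InfVolFermionState 2, ω.IsTranslationInvariant → ω.density = n →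
      ω.meanEnergy (hubbardTTPrimeFermionInteraction t s₀ U) 1 ≤ u → P ω)
    {s : ℝ} (hs : s ∈ Set.Icc s₁ s₂) {ω : InfVolFermionState 2} (hω : ω.IsTranslationInvariant)
    (hρ : ω.density = n)
    (hmin : ω.meanEnergy (hubbardTTPrimeFermionInteraction t s U) 1 ≤ energyDensityTT' t s U n) :
    P ω := by
  refine hP ω hω hρ ?_
  obtain ⟨-, hcap⟩ := hω.meanEnergy_anchor_mem_Icc_of_minimiser_kinematic t s₀ s hU hρ hn0 hn2 hmin
  have hdist : |s - s₀| ≤ max (s₂ - s₀) (s₀ - s₁) := by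
    rw [abs_le]
    constructor
    · have := le_max_right (s₂ - s₀) (s₀ - s₁)
      linarith [hs.1]
    · have := le_max_left (s₂ - s₀) (s₀ - s₁)
      linarith [hs.2]
  have := mul_le_mul_of_nonneg_left hdist (show (0 : ℝ) ≤ 32 / Real.pi ^ 2 by positivity)
  linarith

/-- **Torus-limit ground states are minimisers** (so every theorem of this file applies to them, and to
Bratteli–Robinson ground states via `meanEnergy_eq_energyDensityTT'_of_groundState` of
`FermionGroundStatesMinimiseMeanEnergy`): the hypothesis `hmin` for a torus-limit sector ground state.
[cite: Ruelle1969, §3.4] -/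
theorem IsTorusLimitOf.meanEnergy_le_energyDensityTT'_of_groundState (t s : ℝ) {U : ℝ} (hU : 0 ≤ U)
    {n : ℝ} (hn0 : 0 ≤ n) (hn2 : n < 2)
    {ω : InfVolFermionState 2} {ψ : ∀ L, Fock (Orb (FermionTorus 2 L))} {Ls : ℕ → ℕ}
    (h : ω.IsTorusLimitOf ψ Ls) (hLs : Tendsto Ls atTop atTop)
    (hψ : ∀ j, IsGroundStateInSector (hubbardTorusTT' (Ls j) t s U) (rectN n (Ls j)) 0 (ψ (Ls j)))
    (h1 : ∀ j, star (ψ (Ls j)) ⬝ᵥ ψ (Ls j) = 1) :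
    ω.meanEnergy (hubbardTTPrimeFermionInteraction t s U) 1 ≤ energyDensityTT' t s U n :=
  (h.meanEnergy_hubbardTTPrime_eq_energyDensityTT' t s hU hn0 hn2 hLs hψ h1).le

end InfVolFermionState

end Literature.MathematicalPhysics.QuantumLattice

end
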